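import Mathlib
import Literature.MathematicalPhysics.QuantumFieldTheory.MagnenRivasseauSeneor1993.MRS93OneLoopCounterterms
import Literature.MathematicalPhysics.QuantumFieldTheory.MagnenRivasseauSeneor1993.MRS93AppendixA5Constants
import HarnessLib

/-!
# Magnen–Rivasseau–Sénéor, *Construction of YM₄ with an infrared cutoff* (CMP 155, 1993), §III pp.350–351 and Lemma III.1 (III.2):
# the one-loop A² («mass») counterterm for the cutoff (II.14) — «this A² counterterm is positive (since the contribution is
# negative, see the −2 above)» PROVED for the whole cutoff class, and the printed scaling «b_ρ ≅ b M^{2ρ} λ_ρ²» as the exact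
# degree-2 homogeneity of `∫ d⁴p/p² […κ_ρ(p)…]`

elementary real analysis (a bounded piecewise cutoff against `r dr`, polar coordinates in `ℝ⁴`, the scaling of `d⁴p/p²`); nothing
here is a claim about the Yang–Mills mass gap, about continuum YM₄ on `T⁴` (with or without infrared cutoff), or about the Clay
problem — and nothing about the Feynman rules, the dominance of the one-loop term, or the fine tuning of `b_ρ` is asserted

**Citation header (reproduction of PUBLISHED work).** J. Magnen, V. Rivasseau, R. Sénéor, *Construction of YM₄ with an infrared
cutoff*, Commun. Math. Phys. **155** (1993) 325–383 [MagnenRivasseauSeneor1993], Sect. III «The Effect of the Ultraviolet Cutoff: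
Computation of the Gauge Restoring Counterterms»: the A² graphs p.350 [PDF 26] tl.17–37, the sign discussion p.351 [PDF 27]
tl.2–13, Lemma III.1 (III.2) p.348 [PDF 24]; the cutoff weighting of the same graphs in (VI.14)/(VI.16) pp.372–373 [PDF 48–49];
(II.13)–(II.14) p.331. Loci «p.NNN [PDF nn] tl.k» = journal page, PDF page (= journal page − 324), text-layer line of the held scan
`paper:magnen1993-cmp155-mrs-ym4-infrared-cutoff` (the prose of pp.350–351 is legible in the text layer; (III.2) and (VI.14)/(VI.16)
as quoted from the page renders of record in `MRS93CountertermScaling` ∕ `MRS93OneLoopCounterterms`). Cell pub-balaban-gaps (YM blitz,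
track G3 «MRS 1993 typed AS PRINTED»), seat mrs-lit-2 (gen 19, file 54; companion of file 53 `MRS93OneLoopFiniteTerms`, the A⁴
coefficient); companion record `run/shared/lean/pub/pub-balaban-gaps/g3/MRS-AS-PRINTED-estimates.md`.
**EDITION v1.1 (same seat, gen 20; DOCSTRINGS ONLY — every declaration of v1 byte-identical, no import change):** text-layer
locators of p.351 corrected (its running head is text-layer line 1: «diverges … stabilize the theory» = tl.2–6, «(for the A⁴ term …
see the −2 above)» = tl.2–4), «β = κ_k(u)/v» is p.372 tl.16, and the simplified counterterm bracket is attributed to (VI.14) ∕ (VI.18)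
with (VI.16)'s unsimplified printing quoted beside it — the cell referee's R8 nits (GEN 59); `b_clause_oneLoop`'s docstring now says it
is a constant-sequence limit.

**Imports, nothing restated.** The tree's `MRS93OneLoopCounterterms` (lit-balaban lineage: the printed A² graph totals `OneLoop.G1'`,
`G2'`, `G3'`, `one_loop_A2_sum` («= −2»), and the (VI.16) counterterm bracket `countertermFirstOrder` with `countertermFirstOrder_eq`),
and mrs-lit-1's statement layer `MRS93StartingAnsatz` (`Ansatz.CutoffProfile`, `Ansatz.cutoffFn` = κ of (II.14), `Ansatz.scaledCutoff`
= κ_ρ of (II.13)) via this seat's `MRS93AppendixA5Constants`.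

**What the paper prints (verbatim).**
* p.350 [PDF 26] tl.17–18: *«Let us perform now a similar analysis for the A² counterterm. There are three graphs contributing at
  order λ², pictured in Fig. III.3.»*; tl.21–26 (G′₁): *«… Hence the contribution is −6(1 + (1/ζ − 1)/4) in front of the integration
  over the loop momentum (in units of 1/k²).»*; tl.27–29 (G′₂): *«The contribution is … = (9/2 + 6(1/ζ − 1)/4) in front of the
  integration over the loop momentum.»*; tl.30–34 (G′₃, ghosts): *«The contributions is therefore −2k₁²/k⁴ = −(1/2)/k² in front of
  the integration over the loop momentum.»*; tl.35–37: *«The result for the (A²/2) term in the region where the ultraviolet cutoff is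
  one is obtained by adding all the terms and is −6 − 6/4(1/ζ − 1) − 1/2 + 9/2 + 6/4(1/ζ − 1) = −2 times the loop integration. Remark
  that this result is independent of ζ.»*
* p.351 [PDF 27] tl.2–6: *«[The A² contribution] diverges as ρ → ∞ and requires a counterterm (for the A⁴ term the coefficient of the
  divergent piece is 0, as computed above). However this A² counterterm is positive (since the contribution is negative, see the −2
  above). This is dangerous for stability estimates. We will use the (finite) A⁴ counterterm to control this dangerous A² term and
  stabilize the theory.»*; tl.15–16: *«Remark that since there is one cutoff per propagator the cutoff acts differently G₁, G₂, G₃ and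
  G₄.»*
* Lemma III.1 (III.2) p.348: *«a_ρ ≅ aλ_ρ⁴, b_ρ ≅ bM^{2ρ}λ_ρ², c_ρ ≅ cλ_ρ², d_ρ ≅ dλ_ρ², e_ρ ≅ eλ_ρ⁴. (III.2)»* (typed by this seat's
  file 3 `MRS93CountertermScaling` as the predicate `Counterterms.LemmaIII1ScalingPrinted`).
* (VI.14) p.372 (second bracket; the same simplified form recurs in (VI.18) p.373), the counterterm bracket of the large-field stability
  estimate: *«[∫₀^∞ u du (β/2)[6(1 + (1/ζ−1)/4) − κ(4 + 3(1/ζ−1)/2)](1+t²)]»* — (VI.16) p.373 tl.9 prints the SAME bracket unsimplified,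
  *«[6(1 + (1/ζ−1)/4) − κ((9/2) + 6(1/ζ−1)/4) + κ/2](1+t²)»* (equal; EDITION v1.1 makes the attribution precise, referee GEN 59 nit) —
  with *«β = κ_k(u)/v»* (p.372 tl.16) — i.e. the A² graph totals weighted by `1, κ, κ` per unit of
  `β = κ/v`: the tadpole `G′₁` carries one cutoff factor, `G′₂` and the ghost loop `G′₃` two (the tree's `OneLoop.countertermFirstOrder`,
  docstring «= minus the Sect.-III A² total G′₁ + G′₂ + G′₃ weighted by 1, κ, κ», `countertermFirstOrder_eq`).

**What is formalised (every statement below is a `theorem` with its proof; `P : CutoffProfile` = ANY profile τ, `η > 0`, `t = 1/ζ − 1`).**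
* §1 `bracket2 t κ = G′₁κ + (G′₂ + G′₃)κ²` — the one-loop (A²/2) integrand as a polynomial in the cutoff value, one cutoff per
  propagator (`bracket2_eq_printed`: `−6(1 + t/4)κ + (4 + 3t/2)κ²`); **`bracket2_eq_neg_mul_countertermFirstOrder`** (= `−κ ×` the
  printed (VI.16) counterterm bracket at `t = 1/ζ − 1`: the counterterm cancels the contribution); **`bracket2_one`** `= −2` (the
  printed «−2 … independent of ζ», the tree's `one_loop_A2_sum`); **`bracket2_le`**: for `0 ≤ κ ≤ 1` and `t ≥ −8/3` (every `ζ > 0`,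
  `gaugeParam_t_ge`) `bracket2 t κ ≤ −2κ ≤ 0` — «the contribution is negative» POINTWISE in the cutoff value, not only at `κ = 1`;
  `abs_bracket2_le` (τ-independent bound).
* §2 radial form `massIntegrand P η t r = bracket2(κ(r))·r` (`d⁴p/p² = 2π² r dr`), `= −2r` on `[0, 1]`, `= 0` beyond `3 + η⁻¹`,
  `≤ 0` pointwise, measurable, interval-integrable; **`oneLoopA2Radial P η t := ∫_0^{3+η⁻¹} bracket2(κ(r)) r dr`**;
  **`oneLoopA2Radial_le_neg_one`**: `≤ −1` for EVERY profile τ, every `η > 0`, every `ζ > 0` (the region `κ = 1` alone gives `−1`,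
  the rest is `≤ 0`) — so the A² contribution is STRICTLY NEGATIVE uniformly in the cutoff class (`oneLoopA2Radial_neg`), i.e. the
  A² counterterm is positive, as printed; `abs_oneLoopA2Radial_le` (finite for each `η`: `≤ (|G′₁| + |G′₂ + G′₃|)(3 + η⁻¹)²/2`).
* §3 `d = 4`: **`oneLoopA2Integral P η t := ∫_{ℝ⁴} bracket2(κ(|p|))/|p|² d⁴p`**, **`oneLoopA2Integral_eq`** (`= 2π²·oneLoopA2Radial`,
  polar coordinates, Mathlib `integral_fun_norm_addHaar`; `r³/r² = r`, no singularity), **`oneLoopA2Integral_le`** (`≤ −2π² < 0`);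
  the quadratic divergence AS the printed scaling: **`oneLoopA2Integral_scale`** (`κ(c|p|)` multiplies the integral by `c^{−2}`,
  `d⁴p/p²` having degree 2) and **`oneLoopA2Integral_scaledCutoff`**: with `κ_ρ(p) = κ(pM^{−ρ})` ((II.13), mrs-lit-1's `scaledCutoff`,
  any `M > 0`, any `ρ`) `∫ d⁴p/p² bracket2(κ_ρ(p)) = M^{2ρ}·oneLoopA2Integral` — «diverges as ρ → ∞ and requires a counterterm»
  with the EXACT factor `M^{2ρ}`; **`b_clause_oneLoop`**: for the one-loop model `b_ρ := λ_ρ²·∫ d⁴p/p² bracket2(κ_ρ)` the ratio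
  `b_ρ/(M^{2ρ}λ_ρ²)` is the ρ-independent `b = oneLoopA2Integral P η t` for every `ρ`, hence tends to it («b_ρ ≅ b M^{2ρ} λ_ρ²»,
  the b-component of file 3's `LemmaIII1ScalingPrinted`, one loop), with `b < 0`.

**Readings (declared).** (i) The three graph totals `−6(1 + t/4)`, `9/2 + 6t/4`, `−1/2` are TYPED INPUTS exactly as in
`MRS93OneLoopCounterterms` (Feynman rules, Wick contractions and the `d = 4` conversion not formalised). (ii) «one cutoff per
propagator» (p.351 tl.15–16) fixes the powers `κ¹` (tadpole `G′₁`), `κ²` (`G′₂`, `G′₃`); the paper prints this weighting for the A²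
graphs only inside the Sect. VI bracket (VI.14)/(VI.16) («6(1 + (1/ζ−1)/4) − κ(4 + 3(1/ζ−1)/2)» per unit of `β = κ/v`), which is the
tree's `countertermFirstOrder`; `bracket2_eq_neg_mul_countertermFirstOrder` records the identification. (iii) «the integration over
the loop momentum (in units of 1/k²)» is typed as the integral `∫ d⁴p/p² […]` up to the overall constants the paper drops (p.348
tl.16–18); `oneLoopA2Radial = oneLoopA2Integral/2π²`. Signs are insensitive to these positive factors. (iv) `t ≥ −8/3` is the
only use of the gauge parameter (every `ζ > 0` qualifies, `gaugeParam_t_ge`). (v) `λ`, `κ` are not Lean identifiers here.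

**What is NOT claimed.** The Feynman-rule values; that the one-loop term is the leading contribution of MRS's expansion; the value of
`b` beyond its sign and finiteness; the FINE TUNING of `b_ρ` («The relevant counterterm b_ρ∫_Λ(A²/2) must be fine tuned exactly to
have a renormalized mass which is zero. This is the same problem as fixing the critical bare mass in infrared φ⁴₄ [FMRS1], [R] and
should be solved by a fixed point argument as in [R]», p.347 tl.36–39 — census E7, this seat's file 48 `CriticalMassFixedPoint` for
the [R] mechanism); the other counterterms `c, d, e`; `LemmaIII1ScalingPrinted` itself (a five-fold
conjunction about MRS's actual counterterm family — untouched; `b_clause_oneLoop` is its b-component for the one-loop model only);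
Sect. VI's use of the positive A² counterterm against the A⁴ one ((VI.14)–(VI.35), typed in `MRS93StabilityEstimate` and its
companions); anything of Sects. IV–VIII or of Bałaban's papers. MRS work at FIXED INFRARED CUTOFF in finite volume: nothing here
bears on infinite volume, the continuum limit on `T⁴` as a whole, or a mass gap.
-/

noncomputable section

open Real MeasureTheory MeasureTheory.Measure Set Metric intervalIntegral

namespace Literature.MathematicalPhysics.QuantumFieldTheory.MagnenRivasseauSeneor1993

namespace OneLoopMassCounterterm

open Ansatz OneLoop AppendixOne

variable (P : CutoffProfile) {η : ℝ} (t : ℝ)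

/-! ## §1 The A² bracket with one cutoff per propagator -/

/-- The one-loop `(A²/2)` integrand as a polynomial in the cutoff value `κ`, one cutoff per propagator (p.351 tl.15–16): the
tadpole `G′₁` (one propagator) carries `κ`, the two-propagator graphs `G′₂`, `G′₃` carry `κ²` — the weighting «1, κ, κ» per unit
of `β = κ/v` printed in the counterterm bracket of (VI.14)/(VI.16), `6(1 + (1/ζ−1)/4) − κ(4 + 3(1/ζ−1)/2)` (the tree's
`OneLoop.countertermFirstOrder`, `countertermFirstOrder_eq`). Graph totals = the tree's `OneLoop.G1'`, `G2'`, `G3'` (typed inputs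
as there; `t = 1/ζ − 1`). [cite: MagnenRivasseauSeneor1993, §III p.350 tl.17–37, (VI.16) p.373] -/
def bracket2 (t κ : ℝ) : ℝ := G1' t * κ + (G2' t + G3') * κ ^ 2

/-- The bracket with the printed numbers: `−6(1 + t/4)κ + (9/2 + 6t/4 − 1/2)κ² = −6(1 + t/4)κ + (4 + 3t/2)κ²`.
[cite: MagnenRivasseauSeneor1993, §III p.350] -/
theorem bracket2_eq_printed (t κ : ℝ) : bracket2 t κ = -6 * (1 + t / 4) * κ + (4 + 3 * t / 2) * κ ^ 2 := by
  unfold bracket2 G1' G2' G3'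
  ring

/-- (VI.16): the bracket is `−κ` times the printed counterterm coefficient `6(1 + (1/ζ−1)/4) − κ(4 + 3(1/ζ−1)/2)` at `t = 1/ζ − 1`
(the counterterm CANCELS the contribution). [cite: MagnenRivasseauSeneor1993, (VI.16) p.373, §III p.351 tl.2–4] -/
theorem bracket2_eq_neg_mul_countertermFirstOrder (ζ κ : ℝ) :
    bracket2 (1 / ζ - 1) κ = -κ * countertermFirstOrder ζ κ := by
  rw [countertermFirstOrder_eq]
  unfold bracket2
  ring

/-- «The result for the (A²/2) term in the region where the ultraviolet cutoff is one is obtained by adding all the terms and is …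
= −2 times the loop integration. Remark that this result is independent of ζ.» (p.350 tl.35–37): `bracket2 t 1 = −2`.
[cite: MagnenRivasseauSeneor1993, §III p.350 tl.35–37] -/
theorem bracket2_one : bracket2 t 1 = -2 := by
  have h := one_loop_A2_sum t
  unfold bracket2
  linarith

/-- The bracket vanishes where the cutoff does. [cite: MagnenRivasseauSeneor1993, §III p.350] -/
theorem bracket2_zero : bracket2 t 0 = 0 := by
  unfold bracket2; ring

/-- **«the contribution is negative» (p.351 tl.2–3) — for EVERY cutoff value `0 ≤ κ ≤ 1` and every gauge with `t ≥ −8/3`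
(i.e. every `ζ > 0`, where `t = 1/ζ − 1 > −1`)**: `bracket2 t κ ≤ −2κ ≤ 0` (the two-propagator total `4 + 3t/2 ≥ 0` is largest
at `κ = 1`, where the sum is the printed `−2`). [cite: MagnenRivasseauSeneor1993, §III p.350 tl.35–37, p.351 tl.1–3] -/
theorem bracket2_le {κ : ℝ} (h0 : 0 ≤ κ) (h1 : κ ≤ 1) (ht : -(8 / 3) ≤ t) : bracket2 t κ ≤ -2 * κ := by
  rw [bracket2_eq_printed]
  have hq : 0 ≤ 4 + 3 * t / 2 := by linarith
  have hk : κ ^ 2 ≤ κ := by nlinarith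
  nlinarith [mul_le_mul_of_nonneg_left hk hq]

/-- Every `ζ > 0` gives `t = 1/ζ − 1 > −1 ≥ −8/3`. [cite: MagnenRivasseauSeneor1993, §III p.348 tl.9–11] -/
theorem gaugeParam_t_ge {ζ : ℝ} (hζ : 0 < ζ) : -(8 / 3) ≤ 1 / ζ - 1 := by
  have : 0 < 1 / ζ := by positivity
  linarith

/-- A τ-independent bound: `|bracket2 t κ| ≤ |G′₁| + |G′₂ + G′₃|` on `0 ≤ κ ≤ 1`. [cite: MagnenRivasseauSeneor1993, §III p.350] -/
theorem abs_bracket2_le {κ : ℝ} (h0 : 0 ≤ κ) (h1 : κ ≤ 1) : |bracket2 t κ| ≤ |G1' t| + |G2' t + G3'| := by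
  have hk2 : κ ^ 2 ≤ 1 := pow_le_one₀ h0 h1
  unfold bracket2
  calc |G1' t * κ + (G2' t + G3') * κ ^ 2| ≤ |G1' t * κ| + |(G2' t + G3') * κ ^ 2| := abs_add_le _ _
    _ = |G1' t| * κ + |G2' t + G3'| * κ ^ 2 := by
        rw [abs_mul, abs_mul, abs_of_nonneg h0, abs_of_nonneg (by positivity : (0:ℝ) ≤ κ ^ 2)]
    _ ≤ |G1' t| * 1 + |G2' t + G3'| * 1 := by gcongr
    _ = |G1' t| + |G2' t + G3'| := by ring

/-! ## §2 The radial one-loop A² integral for the cutoff (II.14): `d⁴p/p² = 2π² r dr` -/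

/-- The radial integrand `bracket2(κ(r))·r` (`d⁴p/p² = |S³| r³ dr/r² = 2π² r dr`).
[cite: MagnenRivasseauSeneor1993, (II.14) p.331, §III p.350–351] -/
def massIntegrand (P : CutoffProfile) (η t r : ℝ) : ℝ := bracket2 t (cutoffFn P η r) * r

/-- On `[0, 1]` (`κ = 1`) the integrand is `−2r`. [cite: MagnenRivasseauSeneor1993, (II.14) p.331, §III p.350] -/
theorem massIntegrand_of_le_one {r : ℝ} (hr : r ≤ 1) : massIntegrand P η t r = -2 * r := by
  simp [massIntegrand, cutoffFn_of_le_one P η hr, bracket2_one]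

/-- Beyond `3 + η⁻¹` (`κ = 0`) the integrand vanishes. [cite: MagnenRivasseauSeneor1993, (II.14) p.331] -/
theorem massIntegrand_of_le (hη : 0 < η) {r : ℝ} (hr : 3 + η⁻¹ ≤ r) : massIntegrand P η t r = 0 := by
  simp [massIntegrand, cutoffFn_eq_zero_of_le P η hη hr, bracket2_zero]

/-- Pointwise sign: `massIntegrand ≤ 0` on `r ≥ 0` (every `ζ > 0`). [cite: MagnenRivasseauSeneor1993, §III p.351 tl.1–3] -/
theorem massIntegrand_nonpos (ht : -(8 / 3) ≤ t) {r : ℝ} (hr : 0 ≤ r) : massIntegrand P η t r ≤ 0 := by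
  unfold massIntegrand
  have hb := bracket2_le t (cutoffFn_nonneg P η r) (cutoffFn_le_one P η r) ht
  have hκ := cutoffFn_nonneg P η r
  nlinarith

/-- The cutoff is measurable (monotone). [cite: MagnenRivasseauSeneor1993, (II.14) p.331] -/
theorem measurable_massIntegrand (hη : 0 < η) : Measurable (massIntegrand P η t) := by
  have hκ : Measurable (cutoffFn P η) := (cutoffFn_antitone P η hη).measurable
  unfold massIntegrand bracket2
  fun_prop

/-- Interval integrability on every `[a, b]` with `0 ≤ a ≤ b` (bounded and measurable). [cite: MagnenRivasseauSeneor1993, (II.14) p.331] -/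
theorem massIntegrand_intervalIntegrable (hη : 0 < η) {a b : ℝ} (ha : 0 ≤ a) (hab : a ≤ b) :
    IntervalIntegrable (massIntegrand P η t) volume a b := by
  refine (intervalIntegrable_const (c := (|G1' t| + |G2' t + G3'|) * b)).mono_fun'
    (measurable_massIntegrand P t hη).aestronglyMeasurable ?_
  refine (ae_restrict_mem measurableSet_uIoc).mono fun r hr => ?_
  rw [uIoc_of_le hab] at hr
  have hr0 : 0 ≤ r := ha.trans hr.1.le
  show ‖massIntegrand P η t r‖ ≤ (|G1' t| + |G2' t + G3'|) * b
  rw [Real.norm_eq_abs, massIntegrand, abs_mul, abs_of_nonneg hr0]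
  exact mul_le_mul (abs_bracket2_le t (cutoffFn_nonneg P η r) (cutoffFn_le_one P η r)) hr.2 hr0 (by positivity)

/-- **The one-loop `(A²/2)` coefficient, radial form**, for the cutoff (II.14): `∫_0^{3+η⁻¹} bracket2(κ(r)) r dr` (the
integrand vanishes beyond `3 + η⁻¹`). [cite: MagnenRivasseauSeneor1993, §III p.350–351, (III.2) p.348] -/
def oneLoopA2Radial (P : CutoffProfile) (η t : ℝ) : ℝ := ∫ r in (0 : ℝ)..(3 + η⁻¹), massIntegrand P η t r

/-- **«this A² counterterm is positive (since the contribution is negative, see the −2 above)» (p.351 tl.2–3), PROVED for the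
whole cutoff class (II.14)**: for every profile `τ`, every `η > 0` and every gauge with `t ≥ −8/3` (all `ζ > 0`), the one-loop A²
contribution is `≤ −1 < 0` in radial units (the region `|p| ≤ 1`, where `κ = 1`, alone contributes `∫_0^1 (−2r) dr = −1`, and the
rest is `≤ 0`). [cite: MagnenRivasseauSeneor1993, §III p.350 tl.35–37, p.351 tl.1–3] -/
theorem oneLoopA2Radial_le_neg_one (hη : 0 < η) (ht : -(8 / 3) ≤ t) : oneLoopA2Radial P η t ≤ -1 := by
  have hη' : 0 < η⁻¹ := inv_pos.mpr hη
  have h01 : (0 : ℝ) ≤ 1 := zero_le_one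
  have h13 : (1 : ℝ) ≤ 3 + η⁻¹ := by linarith
  have i1 := massIntegrand_intervalIntegrable P t hη le_rfl h01
  have i2 := massIntegrand_intervalIntegrable P t hη h01 h13
  unfold oneLoopA2Radial
  rw [← integral_add_adjacent_intervals i1 i2]
  have hcore : ∫ r in (0 : ℝ)..1, massIntegrand P η t r = -1 := by
    have : ∫ r in (0 : ℝ)..1, massIntegrand P η t r = ∫ r in (0 : ℝ)..1, -2 * r := by
      refine intervalIntegral.integral_congr fun r hr => ?_
      rw [uIcc_of_le h01] at hr
      exact massIntegrand_of_le_one P t hr.2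
    rw [this, intervalIntegral.integral_const_mul, integral_id]
    norm_num
  have htail : ∫ r in (1 : ℝ)..(3 + η⁻¹), massIntegrand P η t r ≤ 0 := by
    have h := intervalIntegral.integral_mono_on h13 i2 intervalIntegrable_const
      (fun r hr => massIntegrand_nonpos P t ht (zero_le_one.trans hr.1) : ∀ r ∈ Icc (1:ℝ) (3 + η⁻¹), massIntegrand P η t r ≤ (0:ℝ))
    simpa using h
  linarith

/-- Hence strictly negative, uniformly in `η` and in the profile `τ`. [cite: MagnenRivasseauSeneor1993, §III p.351 tl.1–3] -/
theorem oneLoopA2Radial_neg (hη : 0 < η) (ht : -(8 / 3) ≤ t) : oneLoopA2Radial P η t < 0 := by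
  have := oneLoopA2Radial_le_neg_one P t hη ht
  linarith

/-- And bounded: `|∫_0^{3+η⁻¹} bracket2(κ) r dr| ≤ (|G′₁| + |G′₂ + G′₃|)(3 + η⁻¹)²/2` — finite for each `η` (the quadratic divergence of
the A² graphs appears only through the scaling `M^{2ρ}` of §3, «diverges as ρ → ∞ and requires a counterterm», p.351 tl.1–2).
[cite: MagnenRivasseauSeneor1993, §III p.351 tl.1–2] -/
theorem abs_oneLoopA2Radial_le (hη : 0 < η) :
    |oneLoopA2Radial P η t| ≤ (|G1' t| + |G2' t + G3'|) * ((3 + η⁻¹) ^ 2 / 2) := by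
  have hη' : 0 < η⁻¹ := inv_pos.mpr hη
  have hb : (0 : ℝ) ≤ 3 + η⁻¹ := by positivity
  unfold oneLoopA2Radial
  have h := intervalIntegral.norm_integral_le_of_norm_le (f := massIntegrand P η t)
    (g := fun r => (|G1' t| + |G2' t + G3'|) * r) (μ := volume) hb
    (Filter.Eventually.of_forall fun r hr => ?_) ?_
  · rw [Real.norm_eq_abs] at h
    rw [intervalIntegral.integral_const_mul, integral_id] at h
    simpa using h
  · have hr0 : 0 ≤ r := hr.1.le
    rw [Real.norm_eq_abs, massIntegrand, abs_mul, abs_of_nonneg hr0]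
    exact mul_le_mul_of_nonneg_right (abs_bracket2_le t (cutoffFn_nonneg P η r) (cutoffFn_le_one P η r)) hr0
  · exact (continuous_const.mul continuous_id).intervalIntegrable _ _

/-! ## §3 `d = 4`: `∫ d⁴p/p² bracket2(κ_ρ(p)) = M^{2ρ} · ∫ d⁴p/p² bracket2(κ(p))` — the «b M^{2ρ}» of (III.2) at one loop -/

/-- **The one-loop `(A²/2)` integral for the cutoff (II.14) on `ℝ⁴`**: `∫ bracket2(κ(|p|))/|p|² d⁴p`.
[cite: MagnenRivasseauSeneor1993, §III p.350–351, (III.2) p.348] -/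
def oneLoopA2Integral (P : CutoffProfile) (η t : ℝ) : ℝ :=
  ∫ p : EuclideanSpace ℝ (Fin 4), bracket2 t (cutoffFn P η ‖p‖) / ‖p‖ ^ 2

/-- `|S³| = 2π²`: `dim ℝ⁴ · vol(B⁴) = 4 · π²/2`. [folklore] -/
private theorem volume_real_ball_four' :
    (volume : Measure (EuclideanSpace ℝ (Fin 4))).real (ball 0 1) = π ^ 2 / 2 := by
  have hdim : Module.finrank ℝ (EuclideanSpace ℝ (Fin 4)) = 2 * 2 := by
    rw [finrank_euclideanSpace_fin]
  rw [measureReal_def, InnerProductSpace.volume_ball_of_dim_even hdim, hdim]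
  simp only [ENNReal.ofReal_one, one_pow, one_mul, Nat.factorial_two, Nat.cast_ofNat]
  rw [ENNReal.toReal_ofReal (by positivity)]

/-- **Polar coordinates: `∫ d⁴p/p² bracket2(κ(p)) = 2π²·∫_0^{3+η⁻¹} bracket2(κ(r)) r dr`** (`d⁴p = |S³| r³ dr`; the integrand
vanishes beyond `3 + η⁻¹`; no singularity at `p = 0`: `r³/r² = r`). [cite: MagnenRivasseauSeneor1993, §III p.350–351] -/
theorem oneLoopA2Integral_eq (hη : 0 < η) : oneLoopA2Integral P η t = 2 * π ^ 2 * oneLoopA2Radial P η t := by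
  have hη' : 0 < η⁻¹ := inv_pos.mpr hη
  have h03 : (0 : ℝ) ≤ 3 + η⁻¹ := by positivity
  unfold oneLoopA2Integral
  rw [integral_fun_norm_addHaar volume (fun r => bracket2 t (cutoffFn P η r) / r ^ 2), volume_real_ball_four',
    finrank_euclideanSpace_fin]
  have hI : ∫ y in Ioi (0 : ℝ), y ^ (4 - 1) • (bracket2 t (cutoffFn P η y) / y ^ 2) = oneLoopA2Radial P η t := by
    have heq : (fun y : ℝ => y ^ (4 - 1) • (bracket2 t (cutoffFn P η y) / y ^ 2)) =ᵐ[volume.restrict (Ioi (0:ℝ))]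
        (Ioc 0 (3 + η⁻¹)).indicator (massIntegrand P η t) := by
      refine (ae_restrict_mem measurableSet_Ioi).mono fun y hy => ?_
      have hy0 : (0 : ℝ) < y := hy
      have h41 : (4 - 1 : ℕ) = 3 := rfl
      have hval : y ^ (4 - 1) • (bracket2 t (cutoffFn P η y) / y ^ 2) = massIntegrand P η t y := by
        rw [h41, smul_eq_mul, massIntegrand]
        field_simp
      show y ^ (4 - 1) • (bracket2 t (cutoffFn P η y) / y ^ 2) = (Ioc 0 (3 + η⁻¹)).indicator (massIntegrand P η t) y
      rw [hval]
      by_cases hmem : y ∈ Ioc (0 : ℝ) (3 + η⁻¹)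
      · rw [indicator_of_mem hmem]
      · rw [indicator_of_notMem hmem]
        rw [mem_Ioc, not_and_or, not_lt, not_le] at hmem
        rcases hmem with h | h
        · exact absurd hy0 (not_lt.mpr h)
        · exact massIntegrand_of_le P t hη h.le
    rw [integral_congr_ae heq, MeasureTheory.integral_indicator measurableSet_Ioc, Measure.restrict_restrict measurableSet_Ioc,
      show Ioc (0 : ℝ) (3 + η⁻¹) ∩ Ioi 0 = Ioc 0 (3 + η⁻¹) from inter_eq_left.mpr (fun y hy => hy.1),
      ← intervalIntegral.integral_of_le h03]
    rfl
  rw [hI]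
  simp only [nsmul_eq_mul, smul_eq_mul, Nat.cast_ofNat]
  ring

/-- **The contribution is negative in `d = 4` too**: `oneLoopA2Integral ≤ −2π² < 0` for every profile `τ`, every `η > 0`, every
`ζ > 0` — hence a POSITIVE A² counterterm `b_ρ` («dangerous for stability estimates», p.351 tl.3–4).
[cite: MagnenRivasseauSeneor1993, §III p.351 tl.1–4] -/
theorem oneLoopA2Integral_le (hη : 0 < η) (ht : -(8 / 3) ≤ t) : oneLoopA2Integral P η t ≤ -(2 * π ^ 2) := by
  rw [oneLoopA2Integral_eq P t hη]
  have h := oneLoopA2Radial_le_neg_one P t hη ht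
  have hπ : (0 : ℝ) < 2 * π ^ 2 := by positivity
  nlinarith

/-- **The quadratic divergence as the printed scaling `b_ρ ≅ b M^{2ρ} λ_ρ²` of (III.2), at one loop**: with the scaled cutoff
`κ_ρ(p) = κ(pM^{−ρ})` of (II.13) (mrs-lit-1's `Ansatz.scaledCutoff`; indeed any dilation `κ(c|p|)`, `c > 0`) the `d⁴p/p²`-integral
is multiplied by `c^{−2}` (= `M^{2ρ}`): `d⁴p/p²` has degree `2`. [cite: MagnenRivasseauSeneor1993, (III.2) p.348, (II.13) p.331, §III p.351 tl.1–2] -/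
theorem oneLoopA2Integral_scale {c : ℝ} (hc : 0 < c) :
    ∫ p : EuclideanSpace ℝ (Fin 4), bracket2 t (cutoffFn P η (c * ‖p‖)) / ‖p‖ ^ 2 = c⁻¹ ^ 2 * oneLoopA2Integral P η t := by
  have key : (fun p : EuclideanSpace ℝ (Fin 4) => bracket2 t (cutoffFn P η (c * ‖p‖)) / ‖p‖ ^ 2) =
      fun p => c ^ 2 * ((fun q : EuclideanSpace ℝ (Fin 4) => bracket2 t (cutoffFn P η ‖q‖) / ‖q‖ ^ 2) (c • p)) := by
    funext p
    simp only [norm_smul, Real.norm_eq_abs, abs_of_pos hc]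
    rw [mul_pow]
    field_simp
  rw [key, MeasureTheory.integral_const_mul, Measure.integral_comp_smul volume
    (fun q : EuclideanSpace ℝ (Fin 4) => bracket2 t (cutoffFn P η ‖q‖) / ‖q‖ ^ 2) c,
    finrank_euclideanSpace_fin, smul_eq_mul, oneLoopA2Integral]
  have hc4 : |(c ^ 4)⁻¹| = (c ^ 4)⁻¹ := abs_of_pos (by positivity)
  rw [hc4]
  field_simp

/-- With mrs-lit-1's `Ansatz.scaledCutoff P η M ρ r = κ(r·M^{−ρ})`: `∫ d⁴p/p² bracket2(κ_ρ(p)) = M^{2ρ} · oneLoopA2Integral`, every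
`M > 0`, every `ρ` — the «b M^{2ρ}» of (III.2) for the one-loop integral, with `b = oneLoopA2Integral` INDEPENDENT of `ρ` and
NEGATIVE (`oneLoopA2Integral_le`). [cite: MagnenRivasseauSeneor1993, (III.2) p.348, (II.13) p.331] -/
theorem oneLoopA2Integral_scaledCutoff {M : ℝ} (hM : 0 < M) (ρ : ℕ) :
    ∫ p : EuclideanSpace ℝ (Fin 4), bracket2 t (scaledCutoff P η M ρ ‖p‖) / ‖p‖ ^ 2 = M ^ (2 * ρ) * oneLoopA2Integral P η t := by
  have h : ∀ p : EuclideanSpace ℝ (Fin 4), scaledCutoff P η M ρ ‖p‖ = cutoffFn P η (M ^ (-(ρ:ℤ)) * ‖p‖) := by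
    intro p
    rw [scaledCutoff, mul_comm]
  simp_rw [h]
  rw [oneLoopA2Integral_scale P t (zpow_pos hM _)]
  congr 1
  rw [← zpow_neg, neg_neg, ← zpow_natCast, ← zpow_mul, mul_comm]
  norm_cast

/-- **(III.2), b-clause, one-loop mechanism**: the model family `b_ρ := λ_ρ² · ∫ d⁴p/p² bracket2(κ_ρ)` satisfies
`b_ρ/(M^{2ρ}λ_ρ²) = b` for EVERY `ρ` with the ρ-independent `b = oneLoopA2Integral P η t` — so `b_ρ/(M^{2ρ}λ_ρ²) → b` trivially
(the printed «b_ρ ≅ b M^{2ρ} λ_ρ²»), and `b < 0` (a positive counterterm `−b_ρ∫A²/2`… in the paper's sign convention «this A²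
counterterm is positive»). As a `Tendsto` this is the limit of a CONSTANT sequence (`oneLoopA2Integral_scaledCutoff` is the exact per-`ρ` statement;
the `Tendsto` form is only the shape in which file 3's `LemmaIII1ScalingPrinted` consumes it). [cite: MagnenRivasseauSeneor1993, Lemma III.1 (III.2) p.348, §III p.351 tl.2–4] -/
theorem b_clause_oneLoop {M : ℝ} (hM : 0 < M) (lamB : ℕ → ℝ) (hlam : ∀ ρ, lamB ρ ≠ 0) :
    Filter.Tendsto (fun ρ : ℕ => (lamB ρ ^ 2 * ∫ p : EuclideanSpace ℝ (Fin 4), bracket2 t (scaledCutoff P η M ρ ‖p‖) / ‖p‖ ^ 2)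
        / (M ^ (2 * ρ) * lamB ρ ^ 2)) Filter.atTop (nhds (oneLoopA2Integral P η t)) := by
  have h : (fun ρ : ℕ => (lamB ρ ^ 2 * ∫ p : EuclideanSpace ℝ (Fin 4), bracket2 t (scaledCutoff P η M ρ ‖p‖) / ‖p‖ ^ 2)
        / (M ^ (2 * ρ) * lamB ρ ^ 2)) = fun _ => oneLoopA2Integral P η t := by
    funext ρ
    rw [oneLoopA2Integral_scaledCutoff P t hM ρ]
    have hM2 : M ^ (2 * ρ) ≠ 0 := pow_ne_zero _ hM.ne'
    have hl : lamB ρ ^ 2 ≠ 0 := pow_ne_zero _ (hlam ρ)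
    rw [mul_comm (lamB ρ ^ 2), mul_div_mul_right _ _ hl, mul_div_cancel_left₀ _ hM2]
  rw [h]
  exact tendsto_const_nhds

end OneLoopMassCounterterm

end Literature.MathematicalPhysics.QuantumFieldTheory.MagnenRivasseauSeneor1993
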